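import Summits.KontsevichZagierPeriods.KontsevichZagierPeriods.Theorems.RootDecompRelativeModAbsoluteCylLogSplitP35

/-! # `RootDecompRelativeModAbsoluteCylLogSplitP36` — part 11/27 of the mechanical ≤400-line split of `RungClosure.lean` (sha256 f909f334226f0fb5…)
Source: decomp-kz lens-3 g12 `RungClosure.lean` v9 (HOME/decomp-kz-lens-3/g12/, sha256 f909f334…; critic g4-52/g4-57/g5 CLEARED, «lander: split v9 --supports 30572»): BLOCK I (57 g11 monolith decls missing from P01–P25), BLOCK II/III (WildCertAssembly parts 1–6, 8–10: `Leaf.cellLocalWildCert`, `Leaf.cylKernelZeroLog_of_trees`), Parts 12–13 (`Leaf.regKernelPairDegOne_iff_circlePos_of_trees`), BLOCK G13 (Möbius engine, test §C decided).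
Split by census-1 g9 `gen/splitlean.py`: scopes re-opened with their `open`/`variable`/`set_option` context; mathematics and declaration order unchanged. -/

noncomputable section
open Set MeasureTheory Filter Topology
open scoped BigOperators
open Literature.NumberTheory.Transcendental Literature.ModelTheory.ExponentialFields
namespace Summit.KontsevichZagierPeriods.RootDecompRelativeModAbsolute.Rung30571.RegularisedLogLayer.CylLogLeaf

/-- At the LEFT end `u⁺` of a monotonicity cell `(u, v)`: `f → 0` or `|f| ≥ δ > 0` on some `(u, w)`. -/
theorem end_dichotomy_right {f : ℝ → ℝ} {u v : ℝ} (huv : u < v)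
    (h : (∃ C : ℝ, Set.EqOn f (fun _ => C) (Set.Ioo u v)) ∨
      ((StrictMonoOn f (Set.Ioo u v) ∨ StrictAntiOn f (Set.Ioo u v)) ∧ ContinuousOn f (Set.Ioo u v))) :
    Tendsto f (𝓝[>] u) (𝓝 0) ∨ ∃ δ w : ℝ, 0 < δ ∧ u < w ∧ w ≤ v ∧ ∀ t ∈ Set.Ioo u w, δ ≤ |f t| := by
  have hne : (Set.Ioo u v).Nonempty := nonempty_Ioo.2 huv
  rcases h with ⟨C, hC⟩ | ⟨hmono | hanti, -⟩
  · by_cases hC0 : C = 0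
    · left
      have hev : f =ᶠ[𝓝[>] u] fun _ => (0 : ℝ) := by
        filter_upwards [Ioo_mem_nhdsGT huv] with t ht
        rw [hC ht, hC0]
      exact (tendsto_const_nhds (x := (0 : ℝ))).congr' hev.symm
    · right
      exact ⟨|C|, v, abs_pos.2 hC0, huv, le_rfl, fun t ht => by rw [hC ht]⟩
  · -- increasing: near `u` the function is smallest
    by_cases hneg : ∃ t₀ ∈ Set.Ioo u v, f t₀ < 0
    · obtain ⟨t₀, ht₀, hf0⟩ := hneg
      right
      refine ⟨|f t₀|, t₀, abs_pos.2 hf0.ne, ht₀.1, ht₀.2.le, fun t ht => ?_⟩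
      have hlt : f t < f t₀ := hmono ⟨ht.1, ht.2.trans ht₀.2⟩ ht₀ ht.2
      rw [abs_of_neg hf0, abs_of_neg (hlt.trans hf0)]
      linarith
    · have hnn : ∀ t ∈ Set.Ioo u v, 0 ≤ f t := fun t ht => not_lt.1 fun h' => hneg ⟨t, ht, h'⟩
      have hbdd : BddBelow (f '' Set.Ioo u v) := ⟨0, by rintro _ ⟨t, ht, rfl⟩; exact hnn t ht⟩
      have hlim := hmono.monotoneOn.tendsto_nhdsWithin_Ioo_right hne hbdd
      set L := sInf (f '' Set.Ioo u v) with hL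
      have hL0 : 0 ≤ L := le_csInf (hne.image f) (by rintro _ ⟨t, ht, rfl⟩; exact hnn t ht)
      rcases hL0.eq_or_lt with hL0 | hLpos
      · left; rw [hL0]; exact hlim
      · right
        refine ⟨L, v, hLpos, huv, le_rfl, fun t ht => ?_⟩
        have h1 : L ≤ f t := csInf_le hbdd (mem_image_of_mem f ht)
        rwa [abs_of_pos (hLpos.trans_le h1)]
  · -- decreasing: near `u` the function is largest
    by_cases hpos : ∃ t₀ ∈ Set.Ioo u v, 0 < f t₀
    · obtain ⟨t₀, ht₀, hf0⟩ := hpos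
      right
      refine ⟨f t₀, t₀, hf0, ht₀.1, ht₀.2.le, fun t ht => ?_⟩
      have hlt : f t₀ < f t := hanti ⟨ht.1, ht.2.trans ht₀.2⟩ ht₀ ht.2
      rw [abs_of_pos (hf0.trans hlt)]
      exact hlt.le
    · have hnp : ∀ t ∈ Set.Ioo u v, f t ≤ 0 := fun t ht => not_lt.1 fun h' => hpos ⟨t, ht, h'⟩
      have hbdd : BddAbove (f '' Set.Ioo u v) := ⟨0, by rintro _ ⟨t, ht, rfl⟩; exact hnp t ht⟩
      have hlim := hanti.antitoneOn.tendsto_nhdsWithin_Ioo_right hne hbdd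
      set L := sSup (f '' Set.Ioo u v) with hL
      have hL0 : L ≤ 0 := csSup_le (hne.image f) (by rintro _ ⟨t, ht, rfl⟩; exact hnp t ht)
      rcases hL0.eq_or_lt with hL0 | hLneg
      · left; rw [← hL0] at *; exact hL0 ▸ hlim
      · right
        refine ⟨|L|, v, abs_pos.2 hLneg.ne, huv, le_rfl, fun t ht => ?_⟩
        have h1 : f t ≤ L := le_csSup hbdd (mem_image_of_mem f ht)
        rw [abs_of_neg hLneg, abs_of_neg (h1.trans_lt hLneg)]
        linarith

/-- At the RIGHT end `v⁻` of a monotonicity cell `(u, v)`: `f → 0` or `|f| ≥ δ > 0` on some `(w, v)`. -/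
theorem end_dichotomy_left {f : ℝ → ℝ} {u v : ℝ} (huv : u < v)
    (h : (∃ C : ℝ, Set.EqOn f (fun _ => C) (Set.Ioo u v)) ∨
      ((StrictMonoOn f (Set.Ioo u v) ∨ StrictAntiOn f (Set.Ioo u v)) ∧ ContinuousOn f (Set.Ioo u v))) :
    Tendsto f (𝓝[<] v) (𝓝 0) ∨ ∃ δ w : ℝ, 0 < δ ∧ u ≤ w ∧ w < v ∧ ∀ t ∈ Set.Ioo w v, δ ≤ |f t| := by
  have hne : (Set.Ioo u v).Nonempty := nonempty_Ioo.2 huv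
  rcases h with ⟨C, hC⟩ | ⟨hmono | hanti, -⟩
  · by_cases hC0 : C = 0
    · left
      have hev : f =ᶠ[𝓝[<] v] fun _ => (0 : ℝ) := by
        filter_upwards [Ioo_mem_nhdsLT huv] with t ht
        rw [hC ht, hC0]
      exact (tendsto_const_nhds (x := (0 : ℝ))).congr' hev.symm
    · right
      exact ⟨|C|, u, abs_pos.2 hC0, le_rfl, huv, fun t ht => by rw [hC ht]⟩
  · -- increasing: near `v` the function is largest
    by_cases hpos : ∃ t₀ ∈ Set.Ioo u v, 0 < f t₀
    · obtain ⟨t₀, ht₀, hf0⟩ := hpos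
      right
      refine ⟨f t₀, t₀, hf0, ht₀.1.le, ht₀.2, fun t ht => ?_⟩
      have hlt : f t₀ < f t := hmono ht₀ ⟨ht₀.1.trans ht.1, ht.2⟩ ht.1
      rw [abs_of_pos (hf0.trans hlt)]
      exact hlt.le
    · have hnp : ∀ t ∈ Set.Ioo u v, f t ≤ 0 := fun t ht => not_lt.1 fun h' => hpos ⟨t, ht, h'⟩
      have hbdd : BddAbove (f '' Set.Ioo u v) := ⟨0, by rintro _ ⟨t, ht, rfl⟩; exact hnp t ht⟩
      have hlim := hmono.monotoneOn.tendsto_nhdsWithin_Ioo_left hne hbdd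
      set L := sSup (f '' Set.Ioo u v) with hL
      have hL0 : L ≤ 0 := csSup_le (hne.image f) (by rintro _ ⟨t, ht, rfl⟩; exact hnp t ht)
      rcases hL0.eq_or_lt with hL0 | hLneg
      · left; exact hL0 ▸ hlim
      · right
        refine ⟨|L|, u, abs_pos.2 hLneg.ne, le_rfl, huv, fun t ht => ?_⟩
        have h1 : f t ≤ L := le_csSup hbdd (mem_image_of_mem f ht)
        rw [abs_of_neg hLneg, abs_of_neg (h1.trans_lt hLneg)]
        linarith
  · -- decreasing: near `v` the function is smallest
    by_cases hneg : ∃ t₀ ∈ Set.Ioo u v, f t₀ < 0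
    · obtain ⟨t₀, ht₀, hf0⟩ := hneg
      right
      refine ⟨|f t₀|, t₀, abs_pos.2 hf0.ne, ht₀.1.le, ht₀.2, fun t ht => ?_⟩
      have hlt : f t < f t₀ := hanti ht₀ ⟨ht₀.1.trans ht.1, ht.2⟩ ht.1
      rw [abs_of_neg hf0, abs_of_neg (hlt.trans hf0)]
      linarith
    · have hnn : ∀ t ∈ Set.Ioo u v, 0 ≤ f t := fun t ht => not_lt.1 fun h' => hneg ⟨t, ht, h'⟩
      have hbdd : BddBelow (f '' Set.Ioo u v) := ⟨0, by rintro _ ⟨t, ht, rfl⟩; exact hnn t ht⟩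
      have hlim := hanti.antitoneOn.tendsto_nhdsWithin_Ioo_left hne hbdd
      set L := sInf (f '' Set.Ioo u v) with hL
      have hL0 : 0 ≤ L := le_csInf (hne.image f) (by rintro _ ⟨t, ht, rfl⟩; exact hnn t ht)
      rcases hL0.eq_or_lt with hL0 | hLpos
      · left; rw [hL0]; exact hlim
      · right
        refine ⟨L, u, hLpos, le_rfl, huv, fun t ht => ?_⟩
        have h1 : L ≤ f t := csInf_le hbdd (mem_image_of_mem f ht)
        rwa [abs_of_pos (hLpos.trans_le h1)]

/-- **`end_behaviour`** (Step 1 input): a one-variable `ℚ`-semialgebraic function on a bounded open interval has finitely many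
breakpoints off which, on each complementary interval, it is continuous and at each end tends to `0` or stays away from `0`. -/
theorem end_behaviour {f : ℝ → ℝ} {a b : ℝ} (hab : a < b)
    (hf : Literature.NumberTheory.Transcendental.IsSemialgebraicFunOn ℚ {t : Fin 1 → ℝ | t 0 ∈ Set.Ioo a b}
      (fun t => f (t 0))) :
    ∃ s : Finset ℝ, (↑s : Set ℝ) ⊆ Set.Ioo a b ∧
      ∀ u v : ℝ, u < v → (u = a ∨ u ∈ s) → (v = b ∨ v ∈ s) → (∀ x ∈ s, x ∉ Set.Ioo u v) →
        ContinuousOn f (Set.Ioo u v) ∧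
        (Tendsto f (𝓝[>] u) (𝓝 0) ∨ ∃ δ w : ℝ, 0 < δ ∧ u < w ∧ w ≤ v ∧ ∀ t ∈ Set.Ioo u w, δ ≤ |f t|) ∧
        (Tendsto f (𝓝[<] v) (𝓝 0) ∨ ∃ δ w : ℝ, 0 < δ ∧ u ≤ w ∧ w < v ∧ ∀ t ∈ Set.Ioo w v, δ ≤ |f t|) := by
  obtain ⟨s, hs, hcell⟩ := Literature.NumberTheory.Transcendental.semialgebraic_monotonicity_holds a b f hab hf
  refine ⟨s, hs, fun u v huv hu hv hx => ?_⟩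
  have h := hcell u v huv hu hv hx
  refine ⟨?_, end_dichotomy_right huv h, end_dichotomy_left huv h⟩
  rcases h with ⟨C, hC⟩ | ⟨-, hcont⟩
  · exact continuousOn_const.congr hC
  · exact hcont

/-! ## §2 The dichotomy on a whole ONE-ENDED piece (Step 2 of T4)

A piece `(a, c]` with SINGULAR end `a` (resp. `[a, c)` with singular end `c`) and TAME end inside `E` (so `f` is continuous up to and
including the tame end and non-vanishing there): EITHER `f → 0` at the singular end and `f` is bounded on the piece, OR `|f| ≥ δ > 0` on the
whole piece.  (First/last monotonicity cell via `end_behaviour` + compactness away from the singular end.) -/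

/-- Singular end on the LEFT (`a⁺`), tame end `c`. -/
theorem left_end_dichotomy {f : ℝ → ℝ} {a c : ℝ} (hac : a < c)
    (hf : Literature.NumberTheory.Transcendental.IsSemialgebraicFunOn ℚ {t : Fin 1 → ℝ | t 0 ∈ Set.Ioo a c}
      (fun t => f (t 0)))
    (hcont : ContinuousOn f (Set.Ioc a c)) (hne : ∀ t ∈ Set.Ioc a c, f t ≠ 0) :
    (Tendsto f (𝓝[>] a) (𝓝 0) ∧ ∃ B : ℝ, ∀ t ∈ Set.Ioc a c, |f t| ≤ B) ∨
      (∃ δ : ℝ, 0 < δ ∧ ∀ t ∈ Set.Ioc a c, δ ≤ |f t|) := by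
  obtain ⟨s, hs, hcell⟩ := end_behaviour hac hf
  have hv : ∃ v, a < v ∧ v ≤ c ∧ (v = c ∨ v ∈ s) ∧ ∀ x ∈ s, x ∉ Set.Ioo a v := by
    by_cases hsne : s.Nonempty
    · refine ⟨s.min' hsne, (hs (s.min'_mem hsne)).1, (hs (s.min'_mem hsne)).2.le, Or.inr (s.min'_mem hsne),
        fun x hx hxI => ?_⟩
      exact absurd hxI.2 (not_lt.2 (s.min'_le x hx))
    · exact ⟨c, hac, le_rfl, Or.inl rfl, fun x hx => absurd ⟨x, hx⟩ hsne⟩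
  obtain ⟨v, hav, hvc, hvs, hnos⟩ := hv
  obtain ⟨-, hdich, -⟩ := hcell a v hav (Or.inl rfl) hvs hnos
  rcases hdich with h0 | ⟨δ₁, w, hδ₁, haw, hwv, hfar⟩
  · left
    refine ⟨h0, ?_⟩
    have hev : ∀ᶠ t in 𝓝[>] a, |f t| < 1 := by
      have h1 := (Metric.tendsto_nhds.1 h0) 1 one_pos
      refine h1.mono fun t ht => ?_
      simpa [Real.dist_eq] using ht
    obtain ⟨u, hu, huS⟩ := mem_nhdsGT_iff_exists_Ioo_subset.1 hev
    have hu' : a < u := hu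
    have hap : a < min u c := lt_min hu' hac
    obtain ⟨B₁, hB₁⟩ := (isCompact_Icc (a := min u c) (b := c)).exists_bound_of_continuousOn
      (hcont.mono fun t ht => ⟨lt_of_lt_of_le hap ht.1, ht.2⟩)
    refine ⟨max 1 B₁, fun t ht => ?_⟩
    by_cases htp : t < min u c
    · have h1 : |f t| < 1 := huS ⟨ht.1, lt_of_lt_of_le htp (min_le_left _ _)⟩
      exact le_trans h1.le (le_max_left _ _)
    · have h1 := hB₁ t ⟨not_lt.1 htp, ht.2⟩
      rw [Real.norm_eq_abs] at h1
      exact le_trans h1 (le_max_right _ _)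
  · right
    have ham : a < (a + w) / 2 := by linarith
    have hmw : (a + w) / 2 < w := by linarith
    have hmc : (a + w) / 2 ≤ c := by linarith
    have hcontK : ContinuousOn (fun t => |f t|) (Set.Icc ((a + w) / 2) c) :=
      continuous_abs.comp_continuousOn (hcont.mono fun t ht => ⟨lt_of_lt_of_le ham ht.1, ht.2⟩)
    obtain ⟨t₀, ht₀, hmin⟩ := isCompact_Icc.exists_isMinOn (Set.nonempty_Icc.2 hmc) hcontK
    have hδ₂ : 0 < |f t₀| := abs_pos.2 (hne t₀ ⟨lt_of_lt_of_le ham ht₀.1, ht₀.2⟩)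
    refine ⟨min δ₁ |f t₀|, lt_min hδ₁ hδ₂, fun t ht => ?_⟩
    by_cases htw : t < w
    · exact le_trans (min_le_left _ _) (hfar t ⟨ht.1, htw⟩)
    · have htK : t ∈ Set.Icc ((a + w) / 2) c := ⟨by linarith [not_lt.1 htw], ht.2⟩
      exact le_trans (min_le_right _ _) ((isMinOn_iff.1 hmin) t htK)

/-- Singular end on the RIGHT (`c⁻`), tame end `a`. -/
theorem right_end_dichotomy {f : ℝ → ℝ} {a c : ℝ} (hac : a < c)
    (hf : Literature.NumberTheory.Transcendental.IsSemialgebraicFunOn ℚ {t : Fin 1 → ℝ | t 0 ∈ Set.Ioo a c}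
      (fun t => f (t 0)))
    (hcont : ContinuousOn f (Set.Ico a c)) (hne : ∀ t ∈ Set.Ico a c, f t ≠ 0) :
    (Tendsto f (𝓝[<] c) (𝓝 0) ∧ ∃ B : ℝ, ∀ t ∈ Set.Ico a c, |f t| ≤ B) ∨
      (∃ δ : ℝ, 0 < δ ∧ ∀ t ∈ Set.Ico a c, δ ≤ |f t|) := by
  obtain ⟨s, hs, hcell⟩ := end_behaviour hac hf
  have hu : ∃ u, a ≤ u ∧ u < c ∧ (u = a ∨ u ∈ s) ∧ ∀ x ∈ s, x ∉ Set.Ioo u c := by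
    by_cases hsne : s.Nonempty
    · refine ⟨s.max' hsne, (hs (s.max'_mem hsne)).1.le, (hs (s.max'_mem hsne)).2, Or.inr (s.max'_mem hsne),
        fun x hx hxI => ?_⟩
      exact absurd hxI.1 (not_lt.2 (s.le_max' x hx))
    · exact ⟨a, le_rfl, hac, Or.inl rfl, fun x hx => absurd ⟨x, hx⟩ hsne⟩
  obtain ⟨u, hau, huc, hus, hnos⟩ := hu
  obtain ⟨-, -, hdich⟩ := hcell u c huc hus (Or.inl rfl) hnos
  rcases hdich with h0 | ⟨δ₁, w, hδ₁, huw, hwc, hfar⟩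
  · left
    refine ⟨h0, ?_⟩
    have hev : ∀ᶠ t in 𝓝[<] c, |f t| < 1 := by
      have h1 := (Metric.tendsto_nhds.1 h0) 1 one_pos
      refine h1.mono fun t ht => ?_
      simpa [Real.dist_eq] using ht
    obtain ⟨l, hl, hlS⟩ := mem_nhdsLT_iff_exists_Ioo_subset.1 hev
    have hl' : l < c := hl
    have hpc : max l a < c := max_lt hl' hac
    obtain ⟨B₁, hB₁⟩ := (isCompact_Icc (a := a) (b := max l a)).exists_bound_of_continuousOn
      (hcont.mono fun t ht => ⟨ht.1, lt_of_le_of_lt ht.2 hpc⟩)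
    refine ⟨max 1 B₁, fun t ht => ?_⟩
    by_cases htp : max l a < t
    · have h1 : |f t| < 1 := hlS ⟨lt_of_le_of_lt (le_max_left _ _) htp, ht.2⟩
      exact le_trans h1.le (le_max_left _ _)
    · have h1 := hB₁ t ⟨ht.1, not_lt.1 htp⟩
      rw [Real.norm_eq_abs] at h1
      exact le_trans h1 (le_max_right _ _)
  · right
    have hmc : (w + c) / 2 < c := by linarith
    have hwm : w < (w + c) / 2 := by linarith
    have ham : a ≤ (w + c) / 2 := by linarith
    have hcontK : ContinuousOn (fun t => |f t|) (Set.Icc a ((w + c) / 2)) :=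
      continuous_abs.comp_continuousOn (hcont.mono fun t ht => ⟨ht.1, lt_of_le_of_lt ht.2 hmc⟩)
    obtain ⟨t₀, ht₀, hmin⟩ := isCompact_Icc.exists_isMinOn (Set.nonempty_Icc.2 ham) hcontK
    have hδ₂ : 0 < |f t₀| := abs_pos.2 (hne t₀ ⟨ht₀.1, lt_of_le_of_lt ht₀.2 hmc⟩)
    refine ⟨min δ₁ |f t₀|, lt_min hδ₁ hδ₂, fun t ht => ?_⟩
    by_cases htw : w < t
    · exact le_trans (min_le_left _ _) (hfar t ⟨htw, ht.2⟩)
    · have htK : t ∈ Set.Icc a ((w + c) / 2) := ⟨ht.1, by linarith [not_lt.1 htw]⟩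
      exact le_trans (min_le_right _ _) ((isMinOn_iff.1 hmin) t htK)

end Summit.KontsevichZagierPeriods.RootDecompRelativeModAbsolute.Rung30571.RegularisedLogLayer.CylLogLeaf

/-! ## Part 4 — `RatesAtEnd_v2` (g11 companion, verbatim body) -/

namespace Summit.KontsevichZagierPeriods.RootDecompRelativeModAbsolute.Rung30571.RegularisedLogLayer.CylLogLeaf

/-- Lower power bound at `a⁺` for a non-vanishing one-variable `ℚ`-semialgebraic function. -/
theorem lower_power_bound {φ : ℝ → ℝ} {a c : ℝ} (hac : a < c)
    (hφ : IsSemialgebraicFunOn ℚ {x : Fin 1 → ℝ | x 0 ∈ Set.Ioo a c} (fun x => φ (x 0)))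
    (hne : ∀ t ∈ Set.Ioo a c, φ t ≠ 0) :
    ∃ (K : ℕ) (C δ : ℝ), 0 < C ∧ 0 < δ ∧ a + δ ≤ c ∧
      ∀ t ∈ Set.Ioo a (a + δ), C * (t - a) ^ K ≤ |φ t| := by
  have hinv : IsSemialgebraicFunOn ℚ {x : Fin 1 → ℝ | x 0 ∈ Set.Ioo a c} (fun x => (φ (x 0))⁻¹) :=
    hφ.inv (fun x hx => hne (x 0) hx)
  obtain ⟨K, C, δ, hδ, hb⟩ := (oneVarPowerBounds_holds (fun t => (φ t)⁻¹) a c hac hinv).1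
  have hC1 : 0 < max C 1 := lt_max_of_lt_right one_pos
  refine ⟨K, (max C 1)⁻¹, min δ (c - a), inv_pos.2 hC1, lt_min hδ (sub_pos.2 hac),
    by linarith [min_le_right δ (c - a)], ?_⟩
  intro t ht
  have htc : t ∈ Set.Ioo a c := ⟨ht.1, by linarith [ht.2, min_le_right δ (c - a)]⟩
  have htδ : t ∈ Set.Ioo a (a + δ) := ⟨ht.1, by linarith [ht.2, min_le_left δ (c - a)]⟩
  have hs : 0 < t - a := sub_pos.2 ht.1
  have hφt : 0 < |φ t| := abs_pos.2 (hne t htc)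
  have hsK : 0 < (t - a) ^ K := pow_pos hs K
  have h2 : |(φ t)⁻¹| ≤ max C 1 * (t - a) ^ (-(K : ℤ)) :=
    (hb t htδ).trans (mul_le_mul_of_nonneg_right (le_max_left _ _) (zpow_nonneg hs.le _))
  rw [abs_inv, zpow_neg, zpow_natCast, ← div_eq_mul_inv, inv_eq_one_div, div_le_div_iff₀ hφt hsK, one_mul] at h2
  rw [inv_mul_le_iff₀ hC1]
  exact h2

/-- Upper root bound at `a⁺` for a one-variable `ℚ`-semialgebraic function tending to `0`, together with `|φ| ≤ 1`. -/
theorem upper_root_bound {φ : ℝ → ℝ} {a c : ℝ} (hac : a < c)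
    (hφ : IsSemialgebraicFunOn ℚ {x : Fin 1 → ℝ | x 0 ∈ Set.Ioo a c} (fun x => φ (x 0)))
    (h0 : Tendsto φ (𝓝[>] a) (𝓝 0)) :
    ∃ (N : ℕ) (C δ : ℝ), 0 < N ∧ 0 ≤ C ∧ 0 < δ ∧ δ ≤ 1 ∧ a + δ ≤ c ∧
      ∀ t ∈ Set.Ioo a (a + δ), |φ t| ≤ C * (t - a) ^ ((N : ℝ)⁻¹) ∧ |φ t| ≤ 1 := by
  obtain ⟨N, C, δ, hN, hδ, hb⟩ := (oneVarPowerBounds_holds φ a c hac hφ).2 h0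
  have hev : ∀ᶠ t in 𝓝[>] a, dist (φ t) 0 < 1 := Metric.tendsto_nhds.1 h0 1 one_pos
  obtain ⟨u, hu, hsub⟩ := (mem_nhdsGT_iff_exists_Ioo_subset' hac).1 hev
  have hua : 0 < u - a := sub_pos.2 hu
  refine ⟨N, max C 0, min (min δ (u - a)) (min 1 (c - a)), hN, le_max_right _ _,
    lt_min (lt_min hδ hua) (lt_min one_pos (sub_pos.2 hac)), ?_, ?_, ?_⟩
  · exact (min_le_right _ _).trans (min_le_left _ _)
  · linarith [min_le_right (min δ (u - a)) (min 1 (c - a)), min_le_right 1 (c - a)]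
  · intro t ht
    have h1 : t - a < min (min δ (u - a)) (min 1 (c - a)) := by linarith [ht.2]
    have htδ : t ∈ Set.Ioo a (a + δ) :=
      ⟨ht.1, by linarith [min_le_left (min δ (u - a)) (min 1 (c - a)), min_le_left δ (u - a)]⟩
    have htu : t ∈ Set.Ioo a u :=
      ⟨ht.1, by linarith [min_le_left (min δ (u - a)) (min 1 (c - a)), min_le_right δ (u - a)]⟩
    have hs : 0 ≤ t - a := (sub_pos.2 ht.1).le
    refine ⟨(hb t htδ).trans (mul_le_mul_of_nonneg_right (le_max_left _ _) (Real.rpow_nonneg hs _)), ?_⟩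
    have h3 : dist (φ t) 0 < 1 := hsub htu
    rw [Real.dist_eq, sub_zero] at h3
    exact h3.le

end Summit.KontsevichZagierPeriods.RootDecompRelativeModAbsolute.Rung30571.RegularisedLogLayer.CylLogLeaf
end
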